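import Summits.QuantumFields.YangMills.Theorems.BalabanLadderIRTwistedSlabLadderHessian
import HarnessLib

/-!
# K3 at EVERY classical vacuum of the e₂-projected slab weight: gauge covariance of the line Hessian and of the Coulomb slice;
# the ladder-free statement «twisted action `= 0` ⇒ Hessian gap `4 sin²(π/(Nℓ₀))` on the Coulomb slice, uniformly in `L, T`»

HELPER toward stub **T1** `TwistedSlabAnchor` (LINE `twisted-slab-continuity`, crux `IRcof` stmt-QuantumFields-26930, census row 43;
LEAD prover ym-ir-line-tsc-p1 g3; `--supports` the crux, `--as helper`).  Sequel of `…TwistedSlabLadderHessian` (K3 at the decorated ladders)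
and of K2 (`…TwistedSlabVacuumOrbits`: every zero of the twisted action is `g • ladder(A, B, ω^i·1, ω^j·1)`).
* §1 gauge covariance of the data: for a gauge map `g` and the conjugated fluctuation `a^g_μ(x) = g(x)ᴴ a_μ(x) g(x)`:
  `conjTranspose_mul_exp_smul_mul` (`gᴴ e^{tX} g = e^{t gᴴXg}`), `coe_gaugeAct_inv_line` (the gauge transform `g⁻¹ • V t` of a line
  `e^{ta}·(g • U₀)` is the line `e^{t a^g}·U₀`), `covDiv_gaugeAct` (`div_{g•U₀} a (x) = g(x) · div_{U₀} a^g (x) · g(x)ᴴ` — the Coulomb slice is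
  transported by the gauge group), `sum_hsS_conjFluct` (same Hilbert–Schmidt mass), tracelessness ∕ skewness preserved.
* §2 ★★★ `twistedAction_hessian_gap_of_vacuum_specialUnitary`: `SU(N)`, `k` a unit, ANY box `(m+1) × (m+1) × (m₂+1) × (m₃+1)`, ANY
  configuration `U` with ZERO twisted action (fundamental representation, magnetic slab tensor `slabTwist (ω^k·1) 1`) — i.e. any classical
  vacuum of the `z^{k′} = 1` summands of `projSlabZ` —, any traceless skew-Hermitian `a` on the Coulomb slice of `U` (`div_U a = 0`) and any
  family `V t` of `SU(N)` configurations with `↑(V t (x,μ)) = e^{t a_μ(x)} · ↑(U (x,μ))`: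
  `4 sin²(π/(N(m+1))) · Σ_x Σ_μ S(a_μ x) ≤ d²/dt²|₀ Σ_x Σ_{μ<ν} (N − Re tr ρ_fund(w_x · P_{V t}(x)))`.
  No ladder, reference pair or label appears in the hypotheses: K2's classification supplies them.  This is the transversal Morse–Bott
  non-degeneracy of the WHOLE critical manifold of the e₂-projected slab weight modulo gauge, with a constant uniform in the long extents.

HONEST FRAMING: tree-level statements on one box; no joint second-order expansion with remainder (M1), nothing uniform in `β` (M3), no
cluster expansion (M4); T1-box 0∕1, T1 proper 0∕1; nothing here bears on `IRcof`, `IR`, or the Yang–Mills mass gap (Clay: NOT proved);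
R4 = `BalabanLadder.UV` only.  References: M. García Pérez, A. González-Arroyo, M. Okawa, JHEP 10 (2017) 150 §2.2–§2.5; A. González-Arroyo,
hep-th/9807108 §4.2.
-/

set_option autoImplicit false

noncomputable section

open scoped Matrix
open Finset NormedSpace
open Literature.MathematicalPhysics.QuantumFieldTheory Literature.MathematicalPhysics.QuantumLattice
open Literature.MathematicalPhysics.QuantumLattice.WilsonSecondVariation

namespace Summit.QuantumFields.YangMills.Cruxes.IRcof.TwistedSlab

variable {N : ℕ} {n₀ n₁ n₂ n₃ : ℕ}

/-! ## §1 Gauge covariance of the line, of the Coulomb slice and of the mass -/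

section GaugeCov

-- `exp` conjugation is stated through Mathlib's `Matrix.exp_units_conj` (as in lit-4's `WilsonPlaquetteSecondVariation`).
set_option backward.isDefEq.respectTransparency false in
/-- `Γᴴ e^{tX} Γ = e^{t ΓᴴXΓ}` for `ΓΓᴴ = 1 = ΓᴴΓ`. [folklore] -/
theorem conjTranspose_mul_exp_smul_mul {Γ X : Matrix (Fin N) (Fin N) ℂ} (hΓ : Γᴴ * Γ = 1) (hΓ' : Γ * Γᴴ = 1) (t : ℝ) :
    Γᴴ * exp (t • X) * Γ = exp (t • (Γᴴ * X * Γ)) := by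
  let u : (Matrix (Fin N) (Fin N) ℂ)ˣ := ⟨Γᴴ, Γ, hΓ, hΓ'⟩
  have h := Matrix.exp_units_conj u (t • X)
  have hu : (u : Matrix (Fin N) (Fin N) ℂ) = Γᴴ := rfl
  have hui : ((u⁻¹ : (Matrix (Fin N) (Fin N) ℂ)ˣ) : Matrix (Fin N) (Fin N) ℂ) = Γ := rfl
  rw [hu, hui] at h
  rw [← h, Matrix.mul_smul, Matrix.smul_mul]

/-- **The conjugated fluctuation** `a^g_μ(x) = g(x)ᴴ · a_μ(x) · g(x)` (the fluctuation seen from the gauge-transformed frame). [folklore] -/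
def conjFluct (g : FinTorusSite n₀ n₁ n₂ n₃ → Matrix (Fin N) (Fin N) ℂ) (a : Fin 4 → FinTorusSite n₀ n₁ n₂ n₃ → Matrix (Fin N) (Fin N) ℂ) :
    Fin 4 → FinTorusSite n₀ n₁ n₂ n₃ → Matrix (Fin N) (Fin N) ℂ :=
  fun μ x => (g x)ᴴ * a μ x * g x

/-- Conjugated fluctuations of skew-Hermitian fluctuations are skew-Hermitian. [folklore] -/
theorem conjFluct_skew {g : FinTorusSite n₀ n₁ n₂ n₃ → Matrix (Fin N) (Fin N) ℂ} {a : Fin 4 → FinTorusSite n₀ n₁ n₂ n₃ → Matrix (Fin N) (Fin N) ℂ}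
    (hskew : ∀ μ x, (a μ x)ᴴ = -a μ x) (μ : Fin 4) (x : FinTorusSite n₀ n₁ n₂ n₃) : (conjFluct g a μ x)ᴴ = -conjFluct g a μ x := by
  simp only [conjFluct, Matrix.conjTranspose_mul, Matrix.conjTranspose_conjTranspose, hskew, Matrix.mul_neg, Matrix.neg_mul,
    Matrix.mul_assoc]

/-- Conjugated fluctuations of traceless fluctuations are traceless (unitary `g`). [folklore] -/
theorem conjFluct_trace {g : FinTorusSite n₀ n₁ n₂ n₃ → Matrix (Fin N) (Fin N) ℂ} (hg : ∀ x, g x ∈ Matrix.unitaryGroup (Fin N) ℂ)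
    {a : Fin 4 → FinTorusSite n₀ n₁ n₂ n₃ → Matrix (Fin N) (Fin N) ℂ} (htr : ∀ μ x, (a μ x).trace = 0) (μ : Fin 4)
    (x : FinTorusSite n₀ n₁ n₂ n₃) : (conjFluct g a μ x).trace = 0 := by
  have h2 : g x * (g x)ᴴ = 1 := (hg x).2
  rw [conjFluct, Matrix.trace_mul_cycle, h2, Matrix.one_mul, htr]

/-- The conjugated fluctuation has the same Hilbert–Schmidt mass. [folklore] -/
theorem sum_hsS_conjFluct {g : FinTorusSite n₀ n₁ n₂ n₃ → Matrix (Fin N) (Fin N) ℂ} (hg : ∀ x, g x ∈ Matrix.unitaryGroup (Fin N) ℂ)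
    (a : Fin 4 → FinTorusSite n₀ n₁ n₂ n₃ → Matrix (Fin N) (Fin N) ℂ) :
    ∑ x, ∑ μ, (((conjFluct g a μ x)ᴴ * conjFluct g a μ x).trace).re = ∑ x, ∑ μ, (((a μ x)ᴴ * a μ x).trace).re :=
  Finset.sum_congr rfl fun x _ => Finset.sum_congr rfl fun _ _ => hsRe_conj' (hg x).2 _ _

/-- In `SU(N)` the inverse is the adjoint (`rfl`). [folklore] -/
private theorem coe_inv_eq_conjTranspose (g : Matrix.specialUnitaryGroup (Fin N) ℂ) :
    ((g⁻¹ : Matrix.specialUnitaryGroup (Fin N) ℂ) : Matrix (Fin N) (Fin N) ℂ) = (g : Matrix (Fin N) (Fin N) ℂ)ᴴ := rfl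

variable (g : FinTorusSite n₀ n₁ n₂ n₃ → Matrix.specialUnitaryGroup (Fin N) ℂ)

/-- The coerced gauge transform: `↑((g • U)(x,μ)) = ↑g(x) · ↑U(x,μ) · ↑g(x+e_μ)ᴴ`. [folklore] -/
theorem coe_gaugeAct_apply (U : FinTorusSite n₀ n₁ n₂ n₃ × Fin 4 → Matrix.specialUnitaryGroup (Fin N) ℂ)
    (x : FinTorusSite n₀ n₁ n₂ n₃) (μ : Fin 4) :
    ((gaugeAct g U (x, μ) : Matrix.specialUnitaryGroup (Fin N) ℂ) : Matrix (Fin N) (Fin N) ℂ) =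
      (g x : Matrix (Fin N) (Fin N) ℂ) * (U (x, μ) : Matrix (Fin N) (Fin N) ℂ) * ((g (x.shift μ) : Matrix (Fin N) (Fin N) ℂ))ᴴ := by
  rw [gaugeAct_apply, Submonoid.coe_mul, Submonoid.coe_mul, coe_inv_eq_conjTranspose]

/-- ★ **A line through `g • U₀`, gauge-transformed back, is the line of the conjugated fluctuation through `U₀`**:
if `↑(V t (x,μ)) = e^{t a_μ(x)} · ↑((g • U₀)(x,μ))` then `↑((g⁻¹ • V t)(x,μ)) = e^{t a^g_μ(x)} · ↑(U₀ (x,μ))`. [folklore] -/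
theorem coe_gaugeAct_inv_line (U₀ : FinTorusSite n₀ n₁ n₂ n₃ × Fin 4 → Matrix.specialUnitaryGroup (Fin N) ℂ)
    (a : Fin 4 → FinTorusSite n₀ n₁ n₂ n₃ → Matrix (Fin N) (Fin N) ℂ)
    (V : ℝ → FinTorusSite n₀ n₁ n₂ n₃ × Fin 4 → Matrix.specialUnitaryGroup (Fin N) ℂ)
    (hV : ∀ (t : ℝ) (x : FinTorusSite n₀ n₁ n₂ n₃) (μ : Fin 4),
      ((V t (x, μ) : Matrix.specialUnitaryGroup (Fin N) ℂ) : Matrix (Fin N) (Fin N) ℂ) =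
        exp (t • a μ x) * ((gaugeAct g U₀ (x, μ) : Matrix.specialUnitaryGroup (Fin N) ℂ) : Matrix (Fin N) (Fin N) ℂ))
    (t : ℝ) (x : FinTorusSite n₀ n₁ n₂ n₃) (μ : Fin 4) :
    ((gaugeAct g⁻¹ (V t) (x, μ) : Matrix.specialUnitaryGroup (Fin N) ℂ) : Matrix (Fin N) (Fin N) ℂ) =
      exp (t • conjFluct (fun y => (g y : Matrix (Fin N) (Fin N) ℂ)) a μ x) * (U₀ (x, μ) : Matrix (Fin N) (Fin N) ℂ) := by
  have hgx : ((g x : Matrix.specialUnitaryGroup (Fin N) ℂ) : Matrix (Fin N) (Fin N) ℂ)ᴴ * (g x : Matrix (Fin N) (Fin N) ℂ) = 1 := (g x).2.1.1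
  have hgx' : (g x : Matrix (Fin N) (Fin N) ℂ) * ((g x : Matrix.specialUnitaryGroup (Fin N) ℂ) : Matrix (Fin N) (Fin N) ℂ)ᴴ = 1 := (g x).2.1.2
  have hgs : ((g (x.shift μ) : Matrix.specialUnitaryGroup (Fin N) ℂ) : Matrix (Fin N) (Fin N) ℂ)ᴴ * (g (x.shift μ) : Matrix (Fin N) (Fin N) ℂ) = 1 :=
    (g (x.shift μ)).2.1.1
  have hW : exp (t • conjFluct (fun y => (g y : Matrix (Fin N) (Fin N) ℂ)) a μ x) =
      ((g x : Matrix.specialUnitaryGroup (Fin N) ℂ) : Matrix (Fin N) (Fin N) ℂ)ᴴ * exp (t • a μ x) * (g x : Matrix (Fin N) (Fin N) ℂ) := by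
    simp only [conjFluct]; exact (conjTranspose_mul_exp_smul_mul hgx hgx' t).symm
  rw [coe_gaugeAct_apply, Pi.inv_apply, Pi.inv_apply, coe_inv_eq_conjTranspose, coe_inv_eq_conjTranspose, Matrix.conjTranspose_conjTranspose,
    hV, coe_gaugeAct_apply, hW]
  calc ((g x : Matrix.specialUnitaryGroup (Fin N) ℂ) : Matrix (Fin N) (Fin N) ℂ)ᴴ *
        (exp (t • a μ x) * ((g x : Matrix (Fin N) (Fin N) ℂ) * (U₀ (x, μ) : Matrix (Fin N) (Fin N) ℂ) *
          ((g (x.shift μ) : Matrix.specialUnitaryGroup (Fin N) ℂ) : Matrix (Fin N) (Fin N) ℂ)ᴴ)) * (g (x.shift μ) : Matrix (Fin N) (Fin N) ℂ)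
      = ((g x : Matrix.specialUnitaryGroup (Fin N) ℂ) : Matrix (Fin N) (Fin N) ℂ)ᴴ * exp (t • a μ x) * (g x : Matrix (Fin N) (Fin N) ℂ) *
          (U₀ (x, μ) : Matrix (Fin N) (Fin N) ℂ) *
          (((g (x.shift μ) : Matrix.specialUnitaryGroup (Fin N) ℂ) : Matrix (Fin N) (Fin N) ℂ)ᴴ * (g (x.shift μ) : Matrix (Fin N) (Fin N) ℂ)) := by
        simp only [Matrix.mul_assoc]
    _ = ((g x : Matrix.specialUnitaryGroup (Fin N) ℂ) : Matrix (Fin N) (Fin N) ℂ)ᴴ * exp (t • a μ x) * (g x : Matrix (Fin N) (Fin N) ℂ) *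
          (U₀ (x, μ) : Matrix (Fin N) (Fin N) ℂ) := by rw [hgs, Matrix.mul_one]

/-- ★ **The Coulomb slice is transported by the gauge group**: `div_{g•U₀} a (x) = g(x) · div_{U₀} a^g (x) · g(x)ᴴ`. [folklore] -/
theorem covDiv_gaugeAct (U₀ : FinTorusSite n₀ n₁ n₂ n₃ × Fin 4 → Matrix.specialUnitaryGroup (Fin N) ℂ)
    (a : Fin 4 → FinTorusSite n₀ n₁ n₂ n₃ → Matrix (Fin N) (Fin N) ℂ) (x : FinTorusSite n₀ n₁ n₂ n₃) :
    covDiv (fun e => ((gaugeAct g U₀ e : Matrix.specialUnitaryGroup (Fin N) ℂ) : Matrix (Fin N) (Fin N) ℂ)) a x =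
      (g x : Matrix (Fin N) (Fin N) ℂ) * covDiv (fun e => ((U₀ e : Matrix.specialUnitaryGroup (Fin N) ℂ) : Matrix (Fin N) (Fin N) ℂ))
        (conjFluct (fun y => (g y : Matrix (Fin N) (Fin N) ℂ)) a) x * ((g x : Matrix.specialUnitaryGroup (Fin N) ℂ) : Matrix (Fin N) (Fin N) ℂ)ᴴ := by
  have hgx : ((g x : Matrix.specialUnitaryGroup (Fin N) ℂ) : Matrix (Fin N) (Fin N) ℂ)ᴴ * (g x : Matrix (Fin N) (Fin N) ℂ) = 1 := (g x).2.1.1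
  have hgx' : (g x : Matrix (Fin N) (Fin N) ℂ) * ((g x : Matrix.specialUnitaryGroup (Fin N) ℂ) : Matrix (Fin N) (Fin N) ℂ)ᴴ = 1 := (g x).2.1.2
  simp only [covDiv, Finset.mul_sum, Finset.sum_mul, Matrix.mul_sub, Matrix.sub_mul]
  refine Finset.sum_congr rfl fun μ _ => ?_
  have e1 : covShiftAdj (fun e => ((gaugeAct g U₀ e : Matrix.specialUnitaryGroup (Fin N) ℂ) : Matrix (Fin N) (Fin N) ℂ)) μ (a μ) x =
      (g x : Matrix (Fin N) (Fin N) ℂ) * covShiftAdj (fun e => ((U₀ e : Matrix.specialUnitaryGroup (Fin N) ℂ) : Matrix (Fin N) (Fin N) ℂ)) μ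
        (conjFluct (fun y => (g y : Matrix (Fin N) (Fin N) ℂ)) a μ) x * ((g x : Matrix.specialUnitaryGroup (Fin N) ℂ) : Matrix (Fin N) (Fin N) ℂ)ᴴ := by
    simp only [covShiftAdj, conjFluct]
    rw [show ((gaugeAct g U₀ (siteUnshift x μ, μ) : Matrix.specialUnitaryGroup (Fin N) ℂ) : Matrix (Fin N) (Fin N) ℂ) =
        (g (siteUnshift x μ) : Matrix (Fin N) (Fin N) ℂ) * (U₀ (siteUnshift x μ, μ) : Matrix (Fin N) (Fin N) ℂ) *
          ((g x : Matrix.specialUnitaryGroup (Fin N) ℂ) : Matrix (Fin N) (Fin N) ℂ)ᴴ by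
      rw [coe_gaugeAct_apply, shift_siteUnshift]]
    simp only [Matrix.conjTranspose_mul, Matrix.conjTranspose_conjTranspose, Matrix.mul_assoc]
  have e2 : a μ x = (g x : Matrix (Fin N) (Fin N) ℂ) * conjFluct (fun y => (g y : Matrix (Fin N) (Fin N) ℂ)) a μ x *
      ((g x : Matrix.specialUnitaryGroup (Fin N) ℂ) : Matrix (Fin N) (Fin N) ℂ)ᴴ := by
    simp only [conjFluct]
    calc a μ x = ((g x : Matrix (Fin N) (Fin N) ℂ) * ((g x : Matrix.specialUnitaryGroup (Fin N) ℂ) : Matrix (Fin N) (Fin N) ℂ)ᴴ) * a μ x *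
          ((g x : Matrix (Fin N) (Fin N) ℂ) * ((g x : Matrix.specialUnitaryGroup (Fin N) ℂ) : Matrix (Fin N) (Fin N) ℂ)ᴴ) := by
            rw [hgx', Matrix.one_mul, Matrix.mul_one]
      _ = (g x : Matrix (Fin N) (Fin N) ℂ) * (((g x : Matrix.specialUnitaryGroup (Fin N) ℂ) : Matrix (Fin N) (Fin N) ℂ)ᴴ * a μ x *
          (g x : Matrix (Fin N) (Fin N) ℂ)) * ((g x : Matrix.specialUnitaryGroup (Fin N) ℂ) : Matrix (Fin N) (Fin N) ℂ)ᴴ := by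
            simp only [Matrix.mul_assoc]
  rw [e1, ← e2]

end GaugeCov

/-! ## §2 K3 at every classical vacuum -/

section Vacuum

variable [NeZero N] {m m₂ m₃ : ℕ}

/-- ★★★ **K3 AT EVERY CLASSICAL VACUUM OF THE e₂-PROJECTED SLAB WEIGHT (ladder-free form).**  `SU(N)`, `k` a unit, any box
`(m+1) × (m+1) × (m₂+1) × (m₃+1)`.  Let `U` have ZERO twisted Wilson action for the magnetic slab tensor `slabTwist (ω^k·1) 1` in the
defining representation (a classical vacuum of the `z^{k′} = 1` summands of `projSlabZ`; by K2 these are exactly the gauge transforms of the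
decorated twist-eating ladders).  Then for every traceless skew-Hermitian lattice 1-form `a` on the Coulomb slice of `U` (`div_U a = 0`) and
every family of `SU(N)` configurations `V t` with `↑(V t (x,μ)) = e^{t a_μ(x)} · ↑(U (x,μ))`:
`4 sin²(π/(N(m+1))) · Σ_x Σ_μ S(a_μ x) ≤ d²/dt²|₀ Σ_x Σ_{μ<ν} (N − Re tr ρ_fund(w_x · P_{V t}(x)))` — the critical manifold of the e₂-projected
slab weight is transversally non-degenerate modulo gauge, with a constant UNIFORM in the long extents `m₂ + 1 = L`, `m₃ + 1 = T`.
[cite: GarciaperezGonzalezarroyoOkawa2017, §2.2, §2.3, §2.5] [cite: Gonzalezarroyo1998, §4.2] -/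
theorem twistedAction_hessian_gap_of_vacuum_specialUnitary {k : ZMod N} (hk : IsUnit k)
    (U : FinTorusSite (m + 1) (m + 1) (m₂ + 1) (m₃ + 1) × Fin 4 → Matrix.specialUnitaryGroup (Fin N) ℂ)
    (hU : ∑ x : FinTorusSite (m + 1) (m + 1) (m₂ + 1) (m₃ + 1), ∑ q : {q : Fin 4 × Fin 4 // q.1 < q.2},
      ((N : ℝ) - (fundamentalRep (Fin N) (tHooftTwistTensor (slabTwist (suCenter N k : Matrix.specialUnitaryGroup (Fin N) ℂ) 1)
        x q.1.1 q.1.2 * finTorusPlaquette U x q.1.1 q.1.2)).trace.re) = 0)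
    {a : Fin 4 → FinTorusSite (m + 1) (m + 1) (m₂ + 1) (m₃ + 1) → Matrix (Fin N) (Fin N) ℂ}
    (hskew : ∀ μ x, (a μ x)ᴴ = -a μ x) (htr : ∀ μ x, (a μ x).trace = 0)
    (hdiv : ∀ x, covDiv (fun e => ((U e : Matrix.specialUnitaryGroup (Fin N) ℂ) : Matrix (Fin N) (Fin N) ℂ)) a x = 0)
    (V : ℝ → FinTorusSite (m + 1) (m + 1) (m₂ + 1) (m₃ + 1) × Fin 4 → Matrix.specialUnitaryGroup (Fin N) ℂ)
    (hV : ∀ (t : ℝ) (x : FinTorusSite (m + 1) (m + 1) (m₂ + 1) (m₃ + 1)) (μ : Fin 4),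
      ((V t (x, μ) : Matrix.specialUnitaryGroup (Fin N) ℂ) : Matrix (Fin N) (Fin N) ℂ) = exp (t • a μ x) * (U (x, μ) : Matrix (Fin N) (Fin N) ℂ)) :
    4 * Real.sin (Real.pi / ((N : ℝ) * (m + 1 : ℕ))) ^ 2 * ∑ x, ∑ μ, (((a μ x)ᴴ * a μ x).trace).re ≤
      iteratedDeriv 2 (fun t => ∑ x : FinTorusSite (m + 1) (m + 1) (m₂ + 1) (m₃ + 1), ∑ q : {q : Fin 4 × Fin 4 // q.1 < q.2},
        ((N : ℝ) - (fundamentalRep (Fin N) (tHooftTwistTensor (slabTwist (suCenter N k : Matrix.specialUnitaryGroup (Fin N) ℂ) 1)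
          x q.1.1 q.1.2 * finTorusPlaquette (V t) x q.1.1 q.1.2)).trace.re)) 0 := by
  -- K2: a reference pair and the classification of the zero set
  obtain ⟨B, A, hBA⟩ := exists_pair_commutator_eq_suCenter (N := N) k
  obtain ⟨g, i, j, rfl⟩ := (twistedAction_eq_zero_iff_exists_gaugeAct_ladder_specialUnitary hk hBA
    (fundamentalRep_mem_unitaryGroup (n := Fin N)) (fundamentalRep_injective (Fin N)) U).1 hU
  set L := ladderConfig (n₀ := m + 1) (n₁ := m + 1) (n₂ := m₂ + 1) (n₃ := m₃ + 1)
    ![A, B, (suCenter N i : Matrix.specialUnitaryGroup (Fin N) ℂ), (suCenter N j : Matrix.specialUnitaryGroup (Fin N) ℂ)] with hL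
  -- the gauge-transformed line through the ladder
  have hg : ∀ y, ((g y : Matrix.specialUnitaryGroup (Fin N) ℂ) : Matrix (Fin N) (Fin N) ℂ) ∈ Matrix.unitaryGroup (Fin N) ℂ := fun y => (g y).2.1
  have hw : ∀ μ ν, slabTwist (suCenter N k : Matrix.specialUnitaryGroup (Fin N) ℂ) 1 μ ν ∈
      Subgroup.center (Matrix.specialUnitaryGroup (Fin N) ℂ) := fun μ ν => by
    unfold slabTwist; split_ifs
    · exact (suCenter N k).2
    · exact Subgroup.one_mem _
    · exact Subgroup.one_mem _
  have hfun : (fun t => ∑ x : FinTorusSite (m + 1) (m + 1) (m₂ + 1) (m₃ + 1), ∑ q : {q : Fin 4 × Fin 4 // q.1 < q.2},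
        ((N : ℝ) - (fundamentalRep (Fin N) (tHooftTwistTensor (slabTwist (suCenter N k : Matrix.specialUnitaryGroup (Fin N) ℂ) 1)
          x q.1.1 q.1.2 * finTorusPlaquette (V t) x q.1.1 q.1.2)).trace.re)) =
      fun t => ∑ x : FinTorusSite (m + 1) (m + 1) (m₂ + 1) (m₃ + 1), ∑ q : {q : Fin 4 × Fin 4 // q.1 < q.2},
        ((N : ℝ) - (fundamentalRep (Fin N) (tHooftTwistTensor (slabTwist (suCenter N k : Matrix.specialUnitaryGroup (Fin N) ℂ) 1)
          x q.1.1 q.1.2 * finTorusPlaquette (gaugeAct g⁻¹ (V t)) x q.1.1 q.1.2)).trace.re) := by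
    funext t
    conv_lhs => rw [← gaugeAct_gaugeAct_inv g (V t)]
    exact twistedAction_gaugeAct (fundamentalRep (Fin N)) hw g (gaugeAct g⁻¹ (V t))
  rw [hfun, ← sum_hsS_conjFluct hg a]
  have hdiv' : ∀ x, covDiv (fun e => ((L e : Matrix.specialUnitaryGroup (Fin N) ℂ) : Matrix (Fin N) (Fin N) ℂ))
      (conjFluct (fun y => (g y : Matrix (Fin N) (Fin N) ℂ)) a) x = 0 := by
    intro x
    have hx := hdiv x
    rw [covDiv_gaugeAct g L a x] at hx
    have hgx : ((g x : Matrix.specialUnitaryGroup (Fin N) ℂ) : Matrix (Fin N) (Fin N) ℂ)ᴴ * (g x : Matrix (Fin N) (Fin N) ℂ) = 1 := (g x).2.1.1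
    have key : ((g x : Matrix.specialUnitaryGroup (Fin N) ℂ) : Matrix (Fin N) (Fin N) ℂ)ᴴ *
        ((g x : Matrix (Fin N) (Fin N) ℂ) * covDiv (fun e => ((L e : Matrix.specialUnitaryGroup (Fin N) ℂ) : Matrix (Fin N) (Fin N) ℂ))
          (conjFluct (fun y => (g y : Matrix (Fin N) (Fin N) ℂ)) a) x * ((g x : Matrix.specialUnitaryGroup (Fin N) ℂ) : Matrix (Fin N) (Fin N) ℂ)ᴴ) *
        (g x : Matrix (Fin N) (Fin N) ℂ) =
        covDiv (fun e => ((L e : Matrix.specialUnitaryGroup (Fin N) ℂ) : Matrix (Fin N) (Fin N) ℂ))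
          (conjFluct (fun y => (g y : Matrix (Fin N) (Fin N) ℂ)) a) x := by
      calc _ = (((g x : Matrix.specialUnitaryGroup (Fin N) ℂ) : Matrix (Fin N) (Fin N) ℂ)ᴴ * (g x : Matrix (Fin N) (Fin N) ℂ)) *
          covDiv (fun e => ((L e : Matrix.specialUnitaryGroup (Fin N) ℂ) : Matrix (Fin N) (Fin N) ℂ))
            (conjFluct (fun y => (g y : Matrix (Fin N) (Fin N) ℂ)) a) x *
          (((g x : Matrix.specialUnitaryGroup (Fin N) ℂ) : Matrix (Fin N) (Fin N) ℂ)ᴴ * (g x : Matrix (Fin N) (Fin N) ℂ)) := by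
            simp only [Matrix.mul_assoc]
        _ = _ := by rw [hgx, Matrix.one_mul, Matrix.mul_one]
    rw [← key, hx, Matrix.mul_zero, Matrix.zero_mul]
  exact twistedAction_hessian_gap_ladder_specialUnitary hk hBA i j (conjFluct_skew hskew) (conjFluct_trace hg htr) hdiv'
    (fun t => gaugeAct g⁻¹ (V t)) (fun t x μ => coe_gaugeAct_inv_line g L a V hV t x μ)

end Vacuum

end Summit.QuantumFields.YangMills.Cruxes.IRcof.TwistedSlab

end
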